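import Mathlib
import Summits.ResolutionOfSingularities.ResolutionOfSingularities.Theorems.RadicialJungCleanModelsCleanSeqPatching
import Summits.ResolutionOfSingularities.ResolutionOfSingularities.Theorems.RadicialJungCleanModelsCleanPermissibleSeqPoint
import Summits.ResolutionOfSingularities.ResolutionOfSingularities.Theorems.RadicialJungCleanModelsCleanPermissibleSeqClean
import Summits.ResolutionOfSingularities.ResolutionOfSingularities.Theorems.FrobeniusLadderFInjectiveMacaulayficationProp44SliceDimTwoComap
import Literature.AlgebraicGeometry.Resolution.PointCentrePermissible
import HarnessLib

/-!
# Route `RadicialJung`, crux `CleanModels` (stmt-ResolutionOfSingularities-15917), line `Sketch` rev 35, stub 6 `stub_cleanProp44` (X44c):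
# THE CLEAN LOCAL-DIMENSION-TWO POINT SLICE — point blow-ups over an isolated bad closed point of embedding dimension `2`

Work item (W2′) of the memo `Cruxes/CleanModels/Lines/Sketch-memo-4e-cleanPermissible.md` §7 / §4 (a): the clean twin of the [CoP1] Prop. 4.4 slice
✓ `CP2008Prop44.orderReducible_comap_of_isolated_dimTwo` / `…_coheight_two` (`FrobeniusLadderFInjectiveMacaulayficationProp44SliceDimTwoComap.lean`),
in the output currency of X44c.  All centres are closed points (clean-permissible for free, ✓ `IsCleanPermissibleSeq.cons_point`, the line being
clean-regular at every stage by ✓ `IsCleanPermissibleSeq.cleanRegAt`); the unique near point over the blown-up point has embedding dimension `2` and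
strictly smaller colength (✓ `IsBlowup.colength_weakTransform_lt`), induction on the colength; no near point ⇒ the clean sequence so far settles
`V` (✓ `exists_isCleanPermissibleSeq_lt_opens_of_seq`, here re-derived from ✓ `IsCleanPermissibleSeq.exists_restrict_of_isOpenImmersion`).

* `exists_isCleanPermissibleSeq_lt_comap_of_isolated_dimTwo` — the piece form with `spanFinrank 𝔪_x = 2` and finite colength as hypotheses;
* `exists_isCleanPermissibleSeq_lt_comap_of_isolated_coheight_two` — the same with the bookkeeping derived from `V(J)` of codimension `≥ 2`
  and `coheight x = 2` (the shape of the assembly's coheight-2 piece).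

Honest framing: OURS; one more of the four slices of a clean re-threading of `cossartPiltant2008_prop44_holds` (with ✓ `…CleanTauTwoSlice`:
both ISOLATED-POINT slices with `τ ≥ 2` resp. local dimension `2` are now clean; the `τ = 1` point slice, the regular-curve slice and clean
reach-tidy — the ones where curves are blown up — remain); nothing here proves X44c, any case of `CleanModels`, or resolution in characteristic `p`.
-/

noncomputable section

set_option linter.dupNamespace false -- mandated namespace of this single-conjunct summit

open CategoryTheory CategoryTheory.Limits AlgebraicGeometry TopologicalSpace IsLocalRing
open Literature.AlgebraicGeometry.Resolution Literature.AlgebraicGeometry.Motives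
open Scheme.IdealSheafData

namespace Summit.ResolutionOfSingularities.ResolutionOfSingularities.Theorems.RadicialJung.CleanModels

/-- A regular system of parameters is an `IsRsopPart` family (`e = 0`). [cite: Matsumura1987, Thm. 14.2] -/
private theorem isRsopPart_of_span_eq_maximalIdeal {R : Type} [CommRing R] [IsRegularLocalRing R] {n : ℕ} (c : Fin n → R)
    (hc : Ideal.span (Set.range c) = maximalIdeal R) (hd : (maximalIdeal R).spanFinrank = n) : IsRsopPart c := by
  refine ⟨inferInstance, 0, Fin.elim0, ?_, ?_⟩
  · have h := (isRegularLocalRing_iff R).mp inferInstance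
    rw [hd] at h
    rw [← h]
    norm_num
  · have : Set.range (Fin.elim0 : Fin 0 → R) = ∅ := Set.range_eq_empty _
    rw [this, Set.union_empty, hc]

/-- A regular system of parameters of length `2` at a point of embedding dimension `2`. [folklore] -/
private theorem exists_rsop_two {X : Scheme.{0}} {x : X} [IsRegularLocalRing (X.presheaf.stalk x)]
    (hd : (maximalIdeal (X.presheaf.stalk x)).spanFinrank = 2) :
    ∃ c : Fin 2 → X.presheaf.stalk x, Ideal.span (Set.range c) = maximalIdeal _ ∧ IsRsopPart c := by
  obtain ⟨c₀, hc₀⟩ := exists_regularSystemOfParameters (R := X.presheaf.stalk x)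
  let c : Fin 2 → X.presheaf.stalk x := fun i => c₀ (i.cast hd.symm)
  have hrange : Set.range c = Set.range c₀ := by
    ext a
    constructor
    · rintro ⟨i, rfl⟩; exact ⟨i.cast hd.symm, rfl⟩
    · rintro ⟨i, rfl⟩; exact ⟨i.cast hd, by simp [c]⟩
  have hc : Ideal.span (Set.range c) = maximalIdeal _ := by rw [hrange, hc₀]
  exact ⟨c, hc, isRsopPart_of_span_eq_maximalIdeal c hc hd⟩

/-- `a < b ≤ N + 1` in `ℕ∞` gives `a ≤ N`. [folklore] -/
private theorem enat_le_of_lt_of_le_succ {a b : ℕ∞} {N : ℕ} (h1 : a < b) (h2 : b ≤ (N : ℕ∞) + 1) : a ≤ N := by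
  induction b using ENat.recTopCoe with
  | top => exact absurd h2 (by simp)
  | coe k =>
    induction a using ENat.recTopCoe with
    | top => exact absurd h1 (by simp)
    | coe j =>
      have hjk : j < k := by exact_mod_cast h1
      have hk : k ≤ N + 1 := by exact_mod_cast h2
      exact_mod_cast (by omega : j ≤ N)

/-- End game over an open, for this file (from ✓ `IsCleanPermissibleSeq.exists_restrict_of_isOpenImmersion`). [cite: BierstoneGrigorievMilmanWlodarczyk2011, Thm. 8.0.5] -/
private theorem endGame {p : ℕ} {X Z : Scheme.{0}} [IsIntegral X] [IsIntegral Z] [IsLocallyNoetherian X]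
    {J : X.IdealSheafData} {m : ℕ} {G : X.functionField} {σ : Z ⟶ X} [IsDominant σ] {J' : Z.IdealSheafData}
    (hseq : IsCleanPermissibleSeq p σ J m J' G) (V : X.Opens) [IsIntegral ((V : X.Opens) : Scheme.{0})] [IsDominant V.ι]
    (h : ∀ z : Z, (m : ℕ∞) ≤ idealOrder J' z → σ z ∉ (V : Set X)) :
    ∃ (V' : Scheme.{0}) (π : V' ⟶ V) (_ : IsIntegral V') (_ : IsDominant π) (K' : V'.IdealSheafData),
      IsCleanPermissibleSeq p π (J.comap V.ι) m K' (RatFn.functionFieldMap V.ι G) ∧ ∀ y, idealOrder K' y < m := by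
  obtain ⟨W', hW', πW, hπW, K', e', hseqW, he', hcomm, hK', hNW', hNZ⟩ := hseq.exists_restrict_of_isOpenImmersion inferInstance V.ι
  haveI := he'
  haveI := hNW'
  haveI := hNZ
  refine ⟨W', πW, hW', hπW, K', hseqW, fun w => ?_⟩
  rw [hK', idealOrder_comap_of_etale e' J' w]
  by_contra hge
  rw [not_lt] at hge
  refine h (e' w) hge ?_
  have hsq : σ (e' w) = V.ι (πW w) := by
    rw [← Scheme.Hom.comp_apply, hcomm, Scheme.Hom.comp_apply]
  rw [hsq, ← Scheme.Opens.range_ι V]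
  exact ⟨_, rfl⟩

set_option maxHeartbeats 800000 in
-- as in the [CoP1] original: one long assembly of the near-point theory at the new stage
/-- The induction behind `exists_isCleanPermissibleSeq_lt_comap_of_isolated_dimTwo`: stages `Φ : Z → X₀` of a CLEAN-permissible sequence for
`(J₀, m)` and the line of `G` carrying ONE bad closed point `z` of embedding dimension `2` over `V` (all other points of order `≥ m` map outside
`V`), by a bound `N` on the colength at `z`. [cite: CossartPiltant2008, Prop. 4.4 (proof, p. 10); Lemma 4.3 (4)] -/
private theorem comap_dimTwo_clean_aux {p : ℕ} (hp : p.Prime) (N : ℕ) :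
    ∀ {X₀ : Scheme.{0}} [IsIntegral X₀] [IsLocallyNoetherian X₀] [CharP X₀.functionField p] (_hX₀ : Scheme.IsRegular X₀)
      (J₀ : X₀.IdealSheafData) {m : ℕ} (_hm : 1 ≤ m) (G : X₀.functionField)
      (_hG : ∀ x : X₀, CleanRegAt p (algebraMap (X₀.presheaf.stalk x) X₀.functionField) G)
      (V : X₀.Opens) [IsIntegral ((V : X₀.Opens) : Scheme.{0})] [IsDominant V.ι]
      {Z : Scheme.{0}} [IsIntegral Z] [IsLocallyNoetherian Z] (_hZ : Scheme.IsRegular Z) {Φ : Z ⟶ X₀} [IsDominant Φ]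
      {JZ : Z.IdealSheafData} (_hseq : IsCleanPermissibleSeq p Φ J₀ m JZ G) (_hle : ∀ w, idealOrder JZ w ≤ m)
      (z : Z) (_hzc : IsClosed ({z} : Set Z)) (_hbad : ∀ w : Z, (m : ℕ∞) ≤ idealOrder JZ w → w = z ∨ Φ w ∉ (V : Set X₀))
      (_hord : idealOrder JZ z = m) (_hdim : (maximalIdeal (Z.presheaf.stalk z)).spanFinrank = 2)
      (_hlen : Module.length (Z.presheaf.stalk z) (Z.presheaf.stalk z ⧸ stalkIdeal JZ z) ≤ N),
      ∃ (V' : Scheme.{0}) (π : V' ⟶ V) (_ : IsIntegral V') (_ : IsDominant π) (K' : V'.IdealSheafData),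
        IsCleanPermissibleSeq p π (J₀.comap V.ι) m K' (RatFn.functionFieldMap V.ι G) ∧ ∀ y, idealOrder K' y < m := by
  induction N with
  | zero =>
    intro X₀ _ _ _ hX₀ J₀ m hm G hG V _ _ Z _ _ hZ Φ _ JZ hseq hle z hzc hbad hord hdim hlen
    -- impossible: `J_z ⊆ 𝔪_z`, so the colength is positive
    haveI := hZ z
    have hJle : stalkIdeal JZ z ≤ maximalIdeal _ :=
      ((le_idealOrder_iff JZ z m).mp hord.ge).trans (Ideal.pow_le_self (by omega))
    have hnt : Nontrivial (Z.presheaf.stalk z ⧸ stalkIdeal JZ z) :=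
      Ideal.Quotient.nontrivial_iff.mpr (ne_top_of_le_ne_top (maximalIdeal.isMaximal _).ne_top hJle)
    have hpos : 0 < Module.length (Z.presheaf.stalk z) (Z.presheaf.stalk z ⧸ stalkIdeal JZ z) :=
      Module.length_pos_iff.mpr hnt
    exact absurd (lt_of_lt_of_le hpos hlen) (lt_irrefl _)
  | succ N ih =>
    intro X₀ _ _ _ hX₀ J₀ m hm G hG V _ _ Z _ _ hZ Φ _ JZ hseq hle z hzc hbad hord hdim hlen
    classical
    set D : Closeds Z := ⟨{z}, hzc⟩ with hDdef
    have hreg : Scheme.IsRegular (vanishingIdeal D).subscheme := CampaignW46.isRegular_subscheme_vanishingIdeal_singleton hzc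
    have hint : IsIntegral (vanishingIdeal D).subscheme := isIntegral_subscheme_vanishingIdeal_singleton hzc
    have hY : ∀ y ∈ (D : Set Z), idealOrder JZ y = m := fun y hy => by
      have hy' : y = z := hy
      rw [hy']; exact hord
    -- `J_Z ≠ 0`, so the blowing up of the point keeps integrality
    have hJne : JZ ≠ ⊥ := by
      intro hJ
      haveI := hZ z
      have hbot : stalkIdeal (⊥ : Z.IdealSheafData) z = ⊥ := by
        obtain ⟨U, hU, hxU, -⟩ :=
          exists_isAffineOpen_mem_and_subset (X := Z) (x := z) (U := ⊤) (Opens.mem_top _)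
        rw [stalkIdeal_eq_map_germ _ ⟨U, hU⟩ hxU, Scheme.IdealSheafData.ideal_bot, Pi.bot_apply, Ideal.map_bot]
      have h2 := (le_idealOrder_iff (⊥ : Z.IdealSheafData) z (m + 1)).mpr (by rw [hbot]; exact bot_le)
      rw [← hJ, hord] at h2
      exact absurd (by exact_mod_cast h2 : m + 1 ≤ m) (by omega)
    have hDne : vanishingIdeal D ≠ ⊥ := vanishingIdeal_ne_bot_of_forall_idealOrder_eq hJne hm hY
    -- blow up the point: a clean-permissible step (the line is clean-regular at `z`)
    obtain ⟨Z', π, hπ⟩ := exists_isBlowup Z (vanishingIdeal D)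
    haveI : IsLocallyNoetherian Z' := hπ.isLocallyNoetherian
    haveI : IsIntegral Z' := hπ.isIntegral hDne
    haveI : IsDominant π := isDominant_of_isBlowup_of_ne_bot hπ hDne
    have hcleanz : CleanRegAt p (algebraMap (Z.presheaf.stalk z) Z.functionField) (RatFn.functionFieldMap Φ G) :=
      hseq.cleanRegAt hp inferInstance hG z
    have hseq' : IsCleanPermissibleSeq p (π ≫ Φ) J₀ m (controlledTransform π (vanishingIdeal D) JZ m) G :=
      IsCleanPermissibleSeq.cons_point hp π Φ J₀ m JZ G hseq z hzc hint hreg hord hπ hcleanz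
    have hZ' : Scheme.IsRegular Z' := hπ.isRegular_of_isRegular_subscheme hZ hreg
    set J' := controlledTransform π (vanishingIdeal D) JZ m with hJ'def
    have hle' : ∀ w, idealOrder J' w ≤ m := hπ.idealOrder_controlledTransform_le_of_forall hZ hreg hY hle
    -- bad points of `Z'` off the fibre of `z` map outside `V`
    have hoff : ∀ w : Z', π w ≠ z → (m : ℕ∞) ≤ idealOrder J' w → (π ≫ Φ) w ∉ (V : Set X₀) := by
      intro w hπw hw
      have hw' : π w ∉ ((vanishingIdeal D).support : Set Z) := by
        rw [Scheme.IdealSheafData.coe_support_vanishingIdeal]; exact hπw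
      rw [hJ'def, hπ.idealOrder_controlledTransform_of_not_mem JZ m hw'] at hw
      rcases hbad (π w) hw with h | h
      · exact absurd h hπw
      · rwa [Scheme.Hom.comp_apply]
    -- bad points over `z` are near
    have hnear_of : ∀ w : Z', π w = z → (m : ℕ∞) ≤ idealOrder J' w → IsNear π (vanishingIdeal D) JZ m w :=
      fun w _ hw => isNear_iff.mpr (le_antisymm (hle' w) hw)
    by_cases hex : ∃ w : Z', π w = z ∧ IsNear π (vanishingIdeal D) JZ m w
    · -- the (unique) near point: recurse with a smaller colength
      obtain ⟨w₀, hw₀, hnear⟩ := hex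
      haveI : IsRegularLocalRing (Z.presheaf.stalk (π w₀)) := hZ (π w₀)
      haveI : IsRegularLocalRing (Z'.presheaf.stalk w₀) := hZ' w₀
      have hcl : IsClosed ({π w₀} : Set Z) := by rw [hw₀]; exact hzc
      have hDeq : D = ⟨{π w₀}, hcl⟩ := Closeds.ext (by change ({z} : Set Z) = {π w₀}; rw [hw₀])
      have hd : (maximalIdeal (Z.presheaf.stalk (π w₀))).spanFinrank = 2 := by
        rw [CampaignW46.spanFinrank_maximalIdeal_congr hw₀]; exact hdim
      obtain ⟨c, hc, hcr⟩ := exists_rsop_two hd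
      have hgen : stalkIdeal (vanishingIdeal D) (π w₀) = maximalIdeal _ := by
        rw [hDeq]; exact stalkIdeal_vanishingIdeal_singleton hcl
      have hcY : Ideal.span (Set.range c) = stalkIdeal (vanishingIdeal D) (π w₀) := by rw [hc, hgen]
      -- uniqueness of the near point (Lemma 4.3 (4)): the new bad locus over `V` is `{w₀}`
      have hbad' : ∀ w : Z', (m : ℕ∞) ≤ idealOrder J' w → w = w₀ ∨ (π ≫ Φ) w ∉ (V : Set X₀) := by
        intro w hw
        by_cases hπw : π w = z
        · left
          exact hπ.eq_of_isNear_of_isNear_curve hZ hreg hm hY hcr hcY hnear (hnear_of w hπw hw) (hπw.trans hw₀.symm)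
        · exact Or.inr (hoff w hπw hw)
      have hcl' : IsClosed ({w₀} : Set Z') := hπ.isClosed_singleton_of_isNear_curve hZ hZ' hreg hm hY hcl hcr hcY hnear
      have hdim' : (maximalIdeal (Z'.presheaf.stalk w₀)).spanFinrank = 2 := by
        rw [(hπ.isRegularLocalRing_and_spanFinrank_eq_of_isNear_curve hZ hreg hm hY hcr hcY hnear).2, hd]
      have hord' : idealOrder J' w₀ = m := le_antisymm (hle' w₀) (isNear_iff.mp hnear).ge
      have hlenz : Module.length (Z.presheaf.stalk (π w₀)) (Z.presheaf.stalk (π w₀) ⧸ stalkIdeal JZ (π w₀)) ≤ (N : ℕ∞) + 1 := by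
        have h := hlen
        rw [← hw₀] at h
        exact_mod_cast h
      have hfinz : IsFiniteLength (Z.presheaf.stalk (π w₀)) (Z.presheaf.stalk (π w₀) ⧸ stalkIdeal JZ (π w₀)) := by
        rw [← Module.length_ne_top_iff]
        exact ne_top_of_le_ne_top (by simp) hlenz
      have hlt := hπ.colength_weakTransform_lt hm hY rfl (isNear_iff.mp hnear) (hZ (π w₀)) hd hgen hfinz
      have hlen' : Module.length (Z'.presheaf.stalk w₀) (Z'.presheaf.stalk w₀ ⧸ stalkIdeal J' w₀) ≤ N :=
        enat_le_of_lt_of_le_succ hlt hlenz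
      exact ih hX₀ J₀ hm G hG V hZ' hseq' hle' w₀ hcl' hbad' hord' hdim' hlen'
    · -- no near point over `z`: every bad point of `Z'` maps outside `V`
      push Not at hex
      refine endGame hseq' V fun w hw => ?_
      by_cases hπw : π w = z
      · exact absurd (hnear_of w hπw hw) (hex w hπw)
      · exact hoff w hπw hw

/-- **THE CLEAN LOCAL-DIMENSION-TWO POINT SLICE RELATIVE TO AN OPEN.**  `X` regular, integral, locally Noetherian with `char K(X) = p`, the line
of `G` clean-regular at every point; `J`, `m ≥ 1`, `ord ≤ m` everywhere; `V ⊆ X` open (non-empty) and `x ∈ V` a CLOSED point of embedding dimension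
`2` with `ord_x J = m` and `𝒪_{X,x}/J_x` of finite length, such that every point of order `≥ m` is `x` or lies outside `V`.  Then the conclusion of
X44c holds on `V`: some CLEAN-permissible sequence for `(J|_V, m)` and the line of `G|_V` brings the order below `m`.  Clean twin of
✓ `CP2008Prop44.orderReducible_comap_of_isolated_dimTwo`. [cite: CossartPiltant2008, Prop. 4.4 (proof, p. 10); Lemma 4.3 (4)] [cite: Piltant2013, Prop. 5.1] -/
theorem exists_isCleanPermissibleSeq_lt_comap_of_isolated_dimTwo {p : ℕ} (hp : p.Prime) {X : Scheme.{0}} [IsIntegral X]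
    [IsLocallyNoetherian X] [CharP X.functionField p] (hX : Scheme.IsRegular X) (J : X.IdealSheafData) {m : ℕ} (hm : 1 ≤ m)
    (hle : ∀ z, idealOrder J z ≤ m) (G : X.functionField)
    (hG : ∀ x : X, CleanRegAt p (algebraMap (X.presheaf.stalk x) X.functionField) G) (V : X.Opens) (x : X) (_hxV : x ∈ V)
    (hcl : IsClosed ({x} : Set X)) (hbad : ∀ z : X, (m : ℕ∞) ≤ idealOrder J z → z = x ∨ z ∉ (V : Set X))
    (hord : idealOrder J x = m) (hdim : (maximalIdeal (X.presheaf.stalk x)).spanFinrank = 2)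
    (hfin : IsFiniteLength (X.presheaf.stalk x) (X.presheaf.stalk x ⧸ stalkIdeal J x))
    [IsIntegral ((V : X.Opens) : Scheme.{0})] [IsDominant V.ι] :
    ∃ (V' : Scheme.{0}) (π : V' ⟶ V) (_ : IsIntegral V') (_ : IsDominant π) (K' : V'.IdealSheafData),
      IsCleanPermissibleSeq p π (J.comap V.ι) m K' (RatFn.functionFieldMap V.ι G) ∧ ∀ y, idealOrder K' y < m := by
  obtain ⟨N, hN⟩ := ENat.ne_top_iff_exists.mp (Module.length_ne_top_iff.mpr hfin)
  exact comap_dimTwo_clean_aux hp N hX J hm G hG V hX (IsCleanPermissibleSeq.nil J m G) hle x hcl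
    (fun z hz => (hbad z hz).imp id fun h => by simpa using h) hord hdim (by rw [← hN])

/-- **The same with the bookkeeping derived from the fact's data** (the shape of the assembly's coheight-2 piece): `V(J)` of codimension `≥ 2`
and `coheight x = 2` give the embedding dimension (regular stalk) and the finite colength (✓ `mem_maxPoints_support_of_coheight_eq_two`).
Clean twin of ✓ `CP2008Prop44.orderReducible_comap_of_isolated_coheight_two`. [cite: CossartPiltant2008, Prop. 4.4 (proof, p. 10)] -/
theorem exists_isCleanPermissibleSeq_lt_comap_of_isolated_coheight_two {p : ℕ} (hp : p.Prime) {X : Scheme.{0}} [IsIntegral X]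
    [IsLocallyNoetherian X] [CharP X.functionField p] (hX : Scheme.IsRegular X) (J : X.IdealSheafData) {m : ℕ} (hm : 1 ≤ m)
    (hle : ∀ z, idealOrder J z ≤ m) (hcodim : ∀ z ∈ J.support, 1 < Order.coheight z) (G : X.functionField)
    (hG : ∀ x : X, CleanRegAt p (algebraMap (X.presheaf.stalk x) X.functionField) G) (V : X.Opens) (x : X) (hxV : x ∈ V)
    (hcl : IsClosed ({x} : Set X)) (hbad : ∀ z : X, (m : ℕ∞) ≤ idealOrder J z → z = x ∨ z ∉ (V : Set X))
    (hord : idealOrder J x = m) (hcoh : Order.coheight x = 2)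
    [IsIntegral ((V : X.Opens) : Scheme.{0})] [IsDominant V.ι] :
    ∃ (V' : Scheme.{0}) (π : V' ⟶ V) (_ : IsIntegral V') (_ : IsDominant π) (K' : V'.IdealSheafData),
      IsCleanPermissibleSeq p π (J.comap V.ι) m K' (RatFn.functionFieldMap V.ι G) ∧ ∀ y, idealOrder K' y < m := by
  haveI := hX x
  have hsupp : x ∈ (J.support : Set X) := by
    rw [SetLike.mem_coe, ← one_le_idealOrder_iff, hord]
    exact_mod_cast hm
  exact exists_isCleanPermissibleSeq_lt_comap_of_isolated_dimTwo hp hX J hm hle G hG V x hxV hcl hbad hord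
    (spanFinrank_maximalIdeal_stalk_eq x hcoh)
    (isFiniteLength_quotient_stalkIdeal_of_mem_maxPoints (CP2008Prop44.mem_maxPoints_support_of_coheight_eq_two hcodim hsupp hcoh))

end Summit.ResolutionOfSingularities.ResolutionOfSingularities.Theorems.RadicialJung.CleanModels

end
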